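import Literature.NumberTheory.LFunctions.TaoLogElliottProp24
import Literature.NumberTheory.LFunctions.MatomakiRadziwillTaoTheorem17With
import HarnessLib

/-!
# Tao 2016, Proposition 2.4 from Theorem A.2 with an abstract middle term

Topic `Literature/NumberTheory/LFunctions`.  Everything in this file is PROVED; no definitions, no named facts.

`Tao2016_prop24` (T. Tao, Forum Math. Pi 4 (2016) e8, Proposition 2.4; `TaoLogElliottTheorem23.lean`) is proved
in the tree from the named fact `MatomakiRadziwillTao2015_theorem17` (`Tao2016_prop24_of_MRT`,
`TaoLogElliottProp24.lean`), whose own proof in the tree rests on the named fact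
`MatomakiRadziwillTao2015_theoremA2`, reduced to `MatomakiRadziwillTao2015_propA3`.  The only route to the
latter available in this library (Halász for block-restricted sums) gives Theorem A.2 with the middle term
`(1 + M) e^{-M/2}` instead of `(1 + M) e^{-M}` (`TwistedPrimeSumTail.lean`, "Remark on the regions `𝒯₀ ∪ 𝒯₁`";
`MatomakiRadziwillTaoSiftedDistance.lean`, "Status").  This file closes the resulting gap on Tao's side: since
Proposition 2.4 uses Theorem 1.7 only with `M ≥ A/2 → ∞`, ANY form of Theorem A.2 (for completely multiplicative
`f`) whose middle term decays like `e^{-cM}`, `c ≥ 5/24`, suffices —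

* `Tao2016_prop24_of_theorem17With` — Proposition 2.4 from Theorem 1.7 with rate `e^{-M/120}`
  (the statement proved in `MRT2015.A2With.theorem17With`); proof of `Tao2016_prop24_of_MRT` verbatim with
  `A ≥ 240/ℓ₊` in place of `40/ℓ₊`;
* `Tao2016_prop24_of_theoremA2With` — **Proposition 2.4 from the schema `MRT2015.TheoremA2With mid`** for any
  `mid ≥ 0`, antitone on `[1, ∞)`, with `√(mid(12 log W - 48)) ≤ C_m W^{-5/4}` for large `W`;
* `Tao2016_prop24_of_theoremA2With_exp_half` — the instance `mid M = C (1 + M) e^{-M/2}` (`C ≥ 0`), the middle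
  term of the restricted-Halász route: a proof of Theorem A.2 for completely multiplicative `f` with this middle
  term yields `Tao2016_prop24_holds` in one line;
(The named fact `MatomakiRadziwillTao2015_theoremA2` itself instantiates the schema, `MRT2015.theoremA2With_of_theoremA2`,
and so gives Proposition 2.4 again through this file — cf. `Tao2016_prop24_of_theoremA2`, `TaoLogElliottProp24OfPropA3.lean`.)

## References
* T. Tao, Forum Math. Pi 4 (2016), e8; arXiv:1509.05422: Proposition 2.4 and its proof. [cite: TaoFMP2016, Proposition 2.4]
* K. Matomäki, M. Radziwiłł, T. Tao, Algebra & Number Theory 9 (2015): Theorem 1.7, §§2–4, Appendix A.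
  [cite: MatomakiRadziwillTao2015, Theorem 1.7]
-/

noncomputable section

open Finset MeasureTheory

namespace Literature.NumberTheory.LFunctions

open Tao2016

/-! ### The MRT bound for sums over integers, rate `e^{-M/120}` -/

/-- **The Matomäki–Radziwiłł–Tao bound for sums over integers**: for integers `N ≥ H ≥ 10` and a
completely multiplicative `S¹`-valued `g`,
`∑_{n < N} |∑_{j=1}^H g(n+j) e(jα)| ≤ C₀ (e^{-M/120} + log log H/log H + log^{-1/700} N) H N` with
`M = M(g; N, min(log^{1/125} N, log⁵ H))` (the rate `e^{-M/120}` of `MRT2015.A2With.theorem17With`;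
copy of `sum_norm_shortExpSum_le`). [cite: MatomakiRadziwillTao2015, Theorem 1.7] -/
theorem sum_norm_shortExpSum_le120 {C₀ : ℝ}
    (hMRT : ∀ g : ArithmeticFunction ℂ, g.IsMultiplicative → (∀ n, ‖g n‖ ≤ 1) →
      ∀ X H : ℝ, 10 ≤ H → H ≤ X → ∀ α : ℝ,
        ∫ x in (0 : ℝ)..X,
            ‖∑ n ∈ Icc ⌈x⌉₊ ⌊x + H⌋₊,
                g n * Complex.exp (2 * Real.pi * Complex.I * (α : ℂ) * (n : ℂ))‖
          ≤ C₀ * (Real.exp (-(Sieve.nonpretentiousness g X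
                  (min (Real.log X ^ (1 / 125 : ℝ)) (Real.log H ^ (5 : ℝ)))) / 120)
                + Real.log (Real.log H) / Real.log H + 1 / Real.log X ^ (1 / 700 : ℝ)) * H * X)
    {g : ℕ → ℂ} (hcm : ∀ m n : ℕ, 1 ≤ m → 1 ≤ n → g (m * n) = g m * g n)
    (hS : ∀ n : ℕ, 1 ≤ n → ‖g n‖ = 1) {N H : ℕ} (hH : 10 ≤ H) (hHN : H ≤ N) (α : ℝ) :
    ∑ n ∈ Finset.range N, ‖shortExpSum g n H α‖
      ≤ C₀ * (Real.exp (-(Sieve.nonpretentiousness (toArithmeticFunction g) N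
              (min (Real.log N ^ (1 / 125 : ℝ)) (Real.log H ^ (5 : ℝ)))) / 120)
            + Real.log (Real.log H) / Real.log H + 1 / Real.log N ^ (1 / 700 : ℝ)) * H * N := by
  have h := hMRT (toArithmeticFunction g) (isMultiplicative_toArithmeticFunction hcm hS) (norm_toArithmeticFunction_le_one hS)
    (N : ℝ) (H : ℝ) (by exact_mod_cast hH) (by exact_mod_cast hHN) α
  have heq : ∑ n ∈ Finset.range N, ‖shortExpSum g n H α‖
      = ∫ y in (0 : ℝ)..(N : ℝ), mrtIntegrand (toArithmeticFunction g) H α y := by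
    rw [← sum_norm_shortExpSum_eq_integral]
    simp only [shortExpSum_toArithmeticFunction]
  rw [heq]
  exact h

/-! ### Proposition 2.4 from Theorem 1.7 with rate `e^{-M/120}` -/

set_option maxHeartbeats 800000 in
/-- **Tao 2016, Proposition 2.4, from Theorem 1.7 in the form with rate `e^{-M/120}`** (the conclusion of
`MRT2015.A2With.theorem17With`, i.e. Theorem 1.7 run from Theorem A.2 with any admissible middle term; proof of
`Tao2016_prop24_of_MRT` verbatim with `40/ℓ₊ ↦ 240/ℓ₊`).
Constants: `C = 48 C₀ + 2` (`C₀ ≥ 1` the MRT constant), `H₀ = 16`; for given `H₊` put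
`T = max(H₊, 16)`, `ℓ₊ = ℓ(T)`, `θ = ℓ₊/64`, and take `A ≥ max(3, e^T, log⁵ T, 2048/ℓ₊ + 32, 240/ℓ₊,
exp(64 ℓ₊^{-701}), exp(6/ℓ₊))`.  Proof: `∑_{n < N} |∑_{j ≤ H} g₁(n+j)e(jα)| = ∫_0^N` (MRT integrand)
`≤ C₀(e^{-M/120} + ℓ(H) + log^{-1/700} N) H N` for `N ≥ H`; for `N ≥ x^θ` the height change costs
`16/θ + 16 ≤ A/2` in hypothesis (2.7) (`q ≤ log⁵ H ≤ A`, `|t| ≤ N ≤ 3x ≤ Ax`), so `M ≥ A/2` and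
the bracket is `≤ 3ℓ(H)`; the dyadic decomposition of `(x/ω, x]` above `max(8, x^θ, T)`
(`Tao2016.sum_norm_div_high_le`, `card_blocks_le`) and the trivial bound below it
(`sum_inv_low_le`, costing `6 + (ℓ₊/32) log ω`) conclude.
[cite: TaoFMP2016, Proposition 2.4 (proof)] -/
theorem Tao2016_prop24_of_theorem17With
    (h17 : ∃ C : ℝ, ∀ g : ArithmeticFunction ℂ, g.IsMultiplicative → (∀ n, ‖g n‖ ≤ 1) →
      ∀ X H : ℝ, 10 ≤ H → H ≤ X → ∀ α : ℝ,
        ∫ x in (0 : ℝ)..X,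
            ‖∑ n ∈ Icc ⌈x⌉₊ ⌊x + H⌋₊, g n * Complex.exp (2 * Real.pi * Complex.I * (α : ℂ) * (n : ℂ))‖
          ≤ C * (Real.exp (-(Sieve.nonpretentiousness g X
                  (min (Real.log X ^ (1 / 125 : ℝ)) (Real.log H ^ (5 : ℝ)))) / 120)
                + Real.log (Real.log H) / Real.log H + 1 / Real.log X ^ (1 / 700 : ℝ)) * H * X) :
    Tao2016_prop24 := by
  obtain ⟨C₀', hMRT'⟩ := h17
  set C₀ : ℝ := max C₀' 1 with hC₀def
  have hC₀ : 1 ≤ C₀ := le_max_right _ _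
  have hC₀' : C₀' ≤ C₀ := le_max_left _ _
  refine ⟨48 * C₀ + 2, 16, fun Hplus => ?_⟩
  -- parameters depending on `H₊`
  set T : ℕ := max Hplus 16 with hTdef
  have hT16 : (16 : ℝ) ≤ T := by exact_mod_cast le_max_right Hplus 16
  set ℓp : ℝ := ell T with hℓpdef
  have hℓp : 0 < ℓp := ell_pos hT16
  have hℓp1 : ℓp ≤ 1 := ell_le_one hT16
  set θ : ℝ := ℓp / 64 with hθdef
  have hθ : 0 < θ := by positivity
  have hθ1 : θ ≤ 1 := by rw [hθdef]; linarith
  have hθ2 : θ ≤ 1 / 2 := by rw [hθdef]; linarith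
  refine ⟨max (max (max 3 (Real.exp T)) (max (Real.log T ^ 5) (2048 / ℓp + 32)))
    (max (max (240 / ℓp) (Real.exp (64 * (1 / ℓp) ^ 701))) (Real.exp (6 / ℓp))), ?_⟩
  intro A hA x ω hAω hωx hωx' g₁ hcm hS hhyp H hH16 hHH α
  -- unpacking the size of `A`
  rw [max_le_iff, max_le_iff, max_le_iff, max_le_iff, max_le_iff, max_le_iff] at hA
  obtain ⟨⟨⟨hA3, hAT⟩, hAlog5, hA2048⟩, ⟨hA40, hA701⟩, hA6⟩ := hA
  -- basic sizes
  have hT16N : 16 ≤ T := le_max_right Hplus 16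
  have hApos : 0 < A := by linarith
  have hω1 : 1 ≤ ω := by linarith
  have hωpos : 0 < ω := by linarith
  have hx1 : 1 ≤ x := hω1.trans hωx'
  have hxpos : 0 < x := by linarith
  have hlogA : (T : ℝ) ≤ Real.log A := by
    rw [← Real.log_exp T]; exact Real.log_le_log (Real.exp_pos _) hAT
  have hlogω : Real.log A ≤ Real.log ω := Real.log_le_log hApos hAω
  have hlogωx : Real.log ω ≤ Real.log x := Real.log_le_log hωpos hωx'
  have hlogx16 : 16 ≤ Real.log x := by linarith
  have hlogxpos : 0 < Real.log x := by linarith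
  have hlogω1 : 1 ≤ Real.log ω := by linarith
  have hlogω0 : 0 ≤ Real.log ω := by linarith
  have hxT : (T : ℝ) ≤ x := by
    have : Real.log x ≤ x := by linarith [Real.log_le_sub_one_of_pos hxpos]
    linarith
  have hxω : Real.log x ≤ x / ω := by
    -- from `ω ≤ x / log x`
    rw [le_div_iff₀ hωpos]
    have := mul_le_mul_of_nonneg_right hωx hlogxpos.le
    rwa [div_mul_cancel₀ _ hlogxpos.ne', mul_comm] at this
  -- `H`
  have hHT : H ≤ T := hHH.trans (le_max_left _ _)
  have hH16r : (16 : ℝ) ≤ H := by exact_mod_cast hH16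
  have hHTr : (H : ℝ) ≤ T := by exact_mod_cast hHT
  have hH10 : 10 ≤ H := le_trans (by norm_num) hH16
  set ℓ : ℝ := Real.log (Real.log H) / Real.log H with hℓdef
  have hℓell : ℓ = ell H := rfl
  have hℓp_le : ℓp ≤ ℓ := by rw [hℓell, hℓpdef]; exact ell_antitone hH16r hHTr
  have hℓpos : 0 < ℓ := lt_of_lt_of_le hℓp hℓp_le
  have hℓ1 : ℓ ≤ 1 := by rw [hℓell]; exact ell_le_one hH16r
  have hlogH : Real.exp 1 < Real.log H :=
    lt_of_lt_of_le exp_one_lt_log_sixteen (Real.log_le_log (by norm_num) hH16r)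
  have hlogHpos : 0 < Real.log H := lt_trans (Real.exp_pos 1) hlogH
  -- the extension `g` of `g₁` and its hypothesis (2.7)
  set g : ArithmeticFunction ℂ := toArithmeticFunction g₁ with hgdef
  have hgb : ∀ n, ‖g n‖ ≤ 1 := norm_toArithmeticFunction_le_one hS
  have hhyp' : ∀ (q : ℕ) (χ : DirichletCharacter ℂ q) (t : ℝ), 1 ≤ q → (q : ℝ) ≤ A →
      |t| ≤ A * x → A ≤ Sieve.pretentiousDistSq g (Sieve.twistedChar χ t) x := by
    intro q χ t hq hqA ht
    rw [hgdef, pretentiousDistSq_toArithmeticFunction]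
    exact hhyp q χ t hq hqA ht
  -- the truncated normalised short sums as an arithmetic function `c`
  set U : ℕ := ⌊x⌋₊ with hUdef
  set L : ℕ := ⌊x / ω⌋₊ with hLdef
  have hUT : T ≤ U := Nat.le_floor hxT
  have hLU : L ≤ U := Nat.floor_le_floor (div_le_self hxpos.le hω1)
  set cf : ℕ → ℝ := fun m => if m ≤ 2 * U + 2 then ‖shortExpSum g₁ m H α‖ / H else 0 with hcfdef
  have hHpos : (0 : ℝ) < H := by linarith
  have hcf0 : ∀ m, 0 ≤ cf m := by
    intro m; simp only [hcfdef]; split_ifs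
    · positivity
    · exact le_rfl
  have hcf1 : ∀ m, cf m ≤ 1 := by
    intro m; simp only [hcfdef]; split_ifs
    · rw [div_le_one hHpos]; exact norm_shortExpSum_le hS m H α
    · exact zero_le_one
  set c : ArithmeticFunction ℂ := ⟨fun m => if m = 0 then 0 else ((cf m : ℝ) : ℂ), by simp⟩
    with hcdef
  have hc_apply : ∀ m, 1 ≤ m → ‖c m‖ = cf m := by
    intro m hm
    have : c m = ((cf m : ℝ) : ℂ) := by simp [hcdef, show m ≠ 0 by omega]
    rw [this, Complex.norm_real, Real.norm_of_nonneg (hcf0 m)]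
  have hc1 : ∀ m, ‖c m‖ ≤ 1 := by
    intro m
    rcases Nat.eq_zero_or_pos m with rfl | hm
    · simp [hcdef]
    · rw [hc_apply m hm]; exact hcf1 m
  -- the left-hand side in terms of `c`
  have hLHS : logAvgShortExpSum g₁ x ω H α = ∑ n ∈ Ioc L U, ‖c (1 * n + 0)‖ / (n : ℝ) := by
    unfold logAvgShortExpSum
    refine Finset.sum_congr rfl fun n hn => ?_
    have hn := Finset.mem_Ioc.mp hn
    have hn1 : 1 ≤ n := by omega
    rw [one_mul, add_zero, hc_apply n hn1]
    simp only [hcfdef, if_pos (show n ≤ 2 * U + 2 by omega)]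
    rw [div_div]
  -- the mean value bound for `c` on `[Y₁, ∞)`, `Y₁ = max (max 8 x^θ) T`
  set Y₁ : ℝ := max (max 8 (x ^ θ)) T with hY₁def
  have hxθ1 : 1 ≤ x ^ θ := Real.one_le_rpow hx1 hθ.le
  have hxθx : x ^ θ ≤ x := by
    calc x ^ θ ≤ x ^ (1 : ℝ) := Real.rpow_le_rpow_of_exponent_le hx1 hθ1
      _ = x := Real.rpow_one x
  set η : ℝ := 6 * C₀ * ℓ with hηdef
  have hη0 : 0 ≤ η := by positivity
  have hY₁8 : (8 : ℝ) ≤ Y₁ := by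
    rw [hY₁def]; exact le_max_of_le_left (le_max_left _ _)
  have hY₁θ : x ^ θ ≤ Y₁ := by
    rw [hY₁def]; exact le_max_of_le_left (le_max_right _ _)
  have hY₁T : (T : ℝ) ≤ Y₁ := by
    rw [hY₁def]; exact le_max_right _ _
  have hMV : ∀ y : ℝ, Y₁ ≤ y → ∑ m ∈ Icc 1 ⌊y⌋₊, ‖c m‖ ≤ η * y := by
    intro y hy
    have hy8 : 8 ≤ y := hY₁8.trans hy
    have hyθ : x ^ θ ≤ y := hY₁θ.trans hy
    have hyT : (T : ℝ) ≤ y := hY₁T.trans hy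
    have hypos : 0 < y := by linarith
    -- truncation: only `m ≤ N₀ := min ⌊y⌋ (2U+2)` contribute
    set N₀ : ℕ := min ⌊y⌋₊ (2 * U + 2) with hN₀def
    set N : ℕ := N₀ + 1 with hNdef
    have hN₀y : N₀ ≤ ⌊y⌋₊ := min_le_left _ _
    have hN₀U : N₀ ≤ 2 * U + 2 := min_le_right _ _
    have hTy : T ≤ ⌊y⌋₊ := Nat.le_floor hyT
    have hTN₀ : T ≤ N₀ := le_min hTy (by omega)
    have hHN : H ≤ N := by omega
    have hN16 : (16 : ℝ) ≤ N := by exact_mod_cast (show 16 ≤ N by omega)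
    have hNpos : (0 : ℝ) < N := by linarith
    have h1 : ∑ m ∈ Icc 1 ⌊y⌋₊, ‖c m‖ = ∑ m ∈ Icc 1 N₀, cf m := by
      rw [← Finset.sum_subset (Finset.Icc_subset_Icc_right hN₀y)]
      · exact Finset.sum_congr rfl fun m hm => hc_apply m (Finset.mem_Icc.mp hm).1
      · intro m hm hm'
        rw [Finset.mem_Icc] at hm hm'
        rw [hc_apply m hm.1]
        simp only [hcfdef]
        rw [if_neg]
        omega
    have h2 : ∑ m ∈ Icc 1 N₀, cf m ≤ ∑ m ∈ Finset.range N, ‖shortExpSum g₁ m H α‖ / H := by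
      calc ∑ m ∈ Icc 1 N₀, cf m ≤ ∑ m ∈ Icc 1 N₀, ‖shortExpSum g₁ m H α‖ / H := by
            refine Finset.sum_le_sum fun m _ => ?_
            simp only [hcfdef]; split_ifs
            · exact le_rfl
            · positivity
        _ ≤ ∑ m ∈ Finset.range N, ‖shortExpSum g₁ m H α‖ / H := by
            refine Finset.sum_le_sum_of_subset_of_nonneg (fun m hm => ?_) fun _ _ _ => by positivity
            rw [Finset.mem_Icc] at hm; rw [Finset.mem_range]; omega
    -- MRT
    have hMRTN := sum_norm_shortExpSum_le120 hMRT' hcm hS hH10 hHN α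
    set M : ℝ := Sieve.nonpretentiousness (toArithmeticFunction g₁) N
      (min (Real.log N ^ (1 / 125 : ℝ)) (Real.log H ^ (5 : ℝ))) with hMdef
    set B : ℝ := Real.exp (-M / 120) + Real.log (Real.log H) / Real.log H
      + 1 / Real.log N ^ (1 / 700 : ℝ) with hBdef
    -- sizes of `N`
    have hNy : (N : ℝ) ≤ y + 1 := by
      have : (N₀ : ℝ) ≤ ⌊y⌋₊ := by exact_mod_cast hN₀y
      have h3 : (⌊y⌋₊ : ℝ) ≤ y := Nat.floor_le hypos.le
      rw [hNdef]; push_cast; linarith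
    have hN2y : (N : ℝ) ≤ 2 * y := by linarith
    have hNθ : x ^ θ ≤ N := by
      -- both `⌊y⌋ + 1 > y ≥ x^θ` and `2U + 3 > 2x ≥ x^θ`
      rcases le_total ⌊y⌋₊ (2 * U + 2) with hc | hc
      · have : N₀ = ⌊y⌋₊ := min_eq_left hc
        rw [hNdef, this]; push_cast
        linarith [Nat.lt_floor_add_one y]
      · have : N₀ = 2 * U + 2 := min_eq_right hc
        rw [hNdef, this]; push_cast
        have : x < (U : ℝ) + 1 := Nat.lt_floor_add_one x
        linarith
    have hN3x : (N : ℝ) ≤ 3 * x := by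
      have h3 : (N₀ : ℝ) ≤ 2 * U + 2 := by exact_mod_cast hN₀U
      have h4 : (U : ℝ) ≤ x := Nat.floor_le hxpos.le
      rw [hNdef]; push_cast
      have : (16 : ℝ) ≤ T := hT16
      linarith
    have hN4 : (4 : ℝ) ≤ N := by linarith
    -- (i) `M ≥ A/2`
    have hQ1 : 1 ≤ min (Real.log N ^ (1 / 125 : ℝ)) (Real.log H ^ (5 : ℝ)) := by
      refine le_min ?_ ?_
      · refine Real.one_le_rpow ?_ (by norm_num)
        have : Real.exp 1 < Real.log N :=
          lt_of_lt_of_le exp_one_lt_log_sixteen (Real.log_le_log (by norm_num) hN16)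
        linarith [Real.add_one_le_exp (1 : ℝ)]
      · exact Real.one_le_rpow (by linarith [Real.add_one_le_exp (1 : ℝ)]) (by norm_num)
    have hQA : min (Real.log N ^ (1 / 125 : ℝ)) (Real.log H ^ (5 : ℝ)) ≤ A := by
      refine (min_le_right _ _).trans ?_
      calc Real.log H ^ (5 : ℝ) = Real.log H ^ (5 : ℕ) := by
            rw [← Real.rpow_natCast]; norm_num
        _ ≤ Real.log T ^ 5 :=
            pow_le_pow_left₀ hlogHpos.le (Real.log_le_log (by linarith) hHTr) 5
        _ ≤ A := hAlog5
    have hM : A / 2 ≤ M := by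
      rw [hMdef]
      refine le_nonpretentiousness hNpos.le hQ1 fun q χ t hq hqQ ht => ?_
      have hqA : (q : ℝ) ≤ A := hqQ.trans hQA
      have h := pretentiousDistSq_at_height hgb hA3 hx1 hθ hθ1 hN4 hNθ hN3x hhyp' χ hq hqA ht
      have h32 : 16 / θ + 16 ≤ A / 2 := by
        rw [hθdef]
        have : 16 / (ℓp / 64) = 1024 / ℓp := by field_simp; ring
        rw [this]
        have : 2048 / ℓp = 2 * (1024 / ℓp) := by ring
        linarith
      rw [hgdef] at h
      linarith
    -- (ii) the three terms of the bracket are `≤ ℓ`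
    have hB1 : Real.exp (-M / 120) ≤ ℓ := by
      have h1 : Real.exp (-M / 120) ≤ Real.exp (-(A / 240)) := Real.exp_le_exp.mpr (by linarith)
      have h2 : Real.exp (-(A / 240)) ≤ 1 / (A / 240) := exp_neg_le_inv (by linarith)
      have h3 : 1 / (A / 240) ≤ ℓp := by
        rw [div_le_iff₀ (by linarith)]
        have := (div_le_iff₀ hℓp).mp hA40
        linarith
      linarith
    have hB3 : 1 / Real.log N ^ (1 / 700 : ℝ) ≤ ℓ := by
      -- `log N ≥ θ log x ≥ θ log A ≥ ℓp^{-700}`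
      have hlogN : θ * Real.log x ≤ Real.log N := by
        rw [← Real.log_rpow hxpos]
        exact Real.log_le_log (Real.rpow_pos_of_pos hxpos θ) hNθ
      have hlogA' : 64 * (1 / ℓp) ^ 701 ≤ Real.log A := by
        rw [← Real.log_exp (64 * (1 / ℓp) ^ 701)]
        exact Real.log_le_log (Real.exp_pos _) hA701
      have hkey : (1 / ℓp) ^ (700 : ℕ) ≤ Real.log N := by
        have e : θ * (64 * (1 / ℓp) ^ 701) = (1 / ℓp) ^ (700 : ℕ) := by
          rw [hθdef, pow_succ]; field_simp
        calc (1 / ℓp) ^ (700 : ℕ) = θ * (64 * (1 / ℓp) ^ 701) := e.symm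
          _ ≤ θ * Real.log A := mul_le_mul_of_nonneg_left hlogA' hθ.le
          _ ≤ θ * Real.log x := mul_le_mul_of_nonneg_left (hlogω.trans hlogωx) hθ.le
          _ ≤ Real.log N := hlogN
      have hℓpinv : 0 < 1 / ℓp := by positivity
      have hroot : 1 / ℓp ≤ Real.log N ^ (1 / 700 : ℝ) := by
        have h1 : ((1 / ℓp) ^ (700 : ℕ)) ^ ((700 : ℕ)⁻¹ : ℝ) = 1 / ℓp :=
          Real.pow_rpow_inv_natCast hℓpinv.le (by norm_num)
        have h2 : ((1 / ℓp) ^ (700 : ℕ)) ^ ((700 : ℕ)⁻¹ : ℝ) ≤ Real.log N ^ ((700 : ℕ)⁻¹ : ℝ) :=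
          Real.rpow_le_rpow (by positivity) hkey (by positivity)
        rw [h1] at h2
        have h3 : ((700 : ℕ)⁻¹ : ℝ) = 1 / 700 := by norm_num
        rwa [h3] at h2
      have hpos : 0 < Real.log N ^ (1 / 700 : ℝ) := lt_of_lt_of_le hℓpinv hroot
      calc 1 / Real.log N ^ (1 / 700 : ℝ) ≤ 1 / (1 / ℓp) :=
            one_div_le_one_div_of_le hℓpinv hroot
        _ = ℓp := one_div_one_div ℓp
        _ ≤ ℓ := hℓp_le
    have hB : B ≤ 3 * ℓ := by rw [hBdef]; linarith
    have hB0 : 0 ≤ B := by rw [hBdef]; positivity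
    -- assembling the mean value bound
    have h3 : ∑ m ∈ Finset.range N, ‖shortExpSum g₁ m H α‖ ≤ C₀ * B * H * N := by
      have step : C₀' * B * H * N ≤ C₀ * B * H * N := by
        have s1 : C₀' * B ≤ C₀ * B := mul_le_mul_of_nonneg_right hC₀' hB0
        have s2 : C₀' * B * H ≤ C₀ * B * H := mul_le_mul_of_nonneg_right s1 hHpos.le
        exact mul_le_mul_of_nonneg_right s2 hNpos.le
      exact hMRTN.trans step
    calc ∑ m ∈ Icc 1 ⌊y⌋₊, ‖c m‖ = ∑ m ∈ Icc 1 N₀, cf m := h1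
      _ ≤ ∑ m ∈ Finset.range N, ‖shortExpSum g₁ m H α‖ / H := h2
      _ = (∑ m ∈ Finset.range N, ‖shortExpSum g₁ m H α‖) / H := by rw [Finset.sum_div]
      _ ≤ C₀ * B * H * N / H := div_le_div_of_nonneg_right h3 hHpos.le
      _ = C₀ * B * N := by field_simp
      _ ≤ C₀ * (3 * ℓ) * (2 * y) := by
          have : 0 ≤ C₀ := by linarith
          refine mul_le_mul (mul_le_mul_of_nonneg_left hB this) hN2y hNpos.le (by positivity)
      _ = η * y := by rw [hηdef]; ring
  -- split the left-hand side at `Y₁` and apply the dyadic bound above, the trivial bound below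
  rw [hLHS, ← Finset.sum_filter_add_sum_filter_not _ (fun n : ℕ => Y₁ ≤ (n : ℝ))]
  have hhigh := sum_norm_div_high_le c (le_refl 1) hη0 hMV hLU (b := 0)
  have hblocks := card_blocks_le hω1 hωx'
  have hhigh' : ∑ n ∈ (Ioc L U).filter (fun n : ℕ => Y₁ ≤ (n : ℝ)), ‖c (1 * n + 0)‖ / (n : ℝ)
      ≤ 4 * η * Real.log ω + 4 * η := by
    refine hhigh.trans ?_
    have hL2 : (1 : ℝ) / 2 ≤ Real.log 2 := by have := Real.log_two_gt_d9; linarith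
    have hdiv : Real.log ω / Real.log 2 ≤ 2 * Real.log ω := by
      calc Real.log ω / Real.log 2 ≤ Real.log ω / (1 / 2) :=
            div_le_div_of_nonneg_left hlogω0 (by norm_num) hL2
        _ = 2 * Real.log ω := by ring
    have e : η * (2 * (1 : ℕ) + (0 : ℕ)) = 2 * η := by push_cast; ring
    rw [e]
    calc ((Nat.log 2 U : ℝ) - Nat.log 2 L + 1) * (2 * η) ≤ (Real.log ω / Real.log 2 + 2) * (2 * η) :=
          mul_le_mul_of_nonneg_right hblocks (by positivity)
      _ ≤ (2 * Real.log ω + 2) * (2 * η) := mul_le_mul_of_nonneg_right (by linarith) (by positivity)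
      _ = 4 * η * Real.log ω + 4 * η := by ring
  -- below `Y₁`: since `n > x/ω ≥ log x ≥ T`, the condition `¬ (Y₁ ≤ n)` is `¬ (max 8 x^θ ≤ n)`
  have hlow' : ∑ n ∈ (Ioc L U).filter (fun n : ℕ => ¬ (Y₁ ≤ (n : ℝ))), ‖c (1 * n + 0)‖ / (n : ℝ)
      ≤ 6 + 2 * θ * Real.log ω := by
    have hfilt : (Ioc L U).filter (fun n : ℕ => ¬ (Y₁ ≤ (n : ℝ)))
        = (Ioc L U).filter (fun n : ℕ => ¬ (max 8 (x ^ θ) ≤ (n : ℝ))) := by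
      refine Finset.filter_congr fun n hn => ?_
      have hn1 : L + 1 ≤ n := (Finset.mem_Ioc.mp hn).1
      have hnT : (T : ℝ) ≤ n := by
        have h1 : x / ω < (L : ℝ) + 1 := Nat.lt_floor_add_one _
        have h2 : ((L + 1 : ℕ) : ℝ) ≤ n := by exact_mod_cast hn1
        push_cast at h2
        linarith
      rw [hY₁def, max_le_iff]
      tauto
    rw [hfilt]
    refine le_trans (Finset.sum_le_sum fun n hn => ?_) (sum_inv_low_le hω1 hωx' hθ hθ2)
    rw [← one_div]
    exact div_le_div_of_nonneg_right (hc1 _) (Nat.cast_nonneg n)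
  -- final arithmetic: everything is `≤ (48 C₀ + 2) ℓ log ω`
  have h6 : 6 ≤ ℓ * Real.log ω := by
    have h1 : 6 / ℓp ≤ Real.log A := by
      rw [← Real.log_exp (6 / ℓp)]; exact Real.log_le_log (Real.exp_pos _) hA6
    have h2 : 6 ≤ ℓp * Real.log ω := by
      have := (div_le_iff₀ hℓp).mp (h1.trans hlogω)
      linarith
    have h3 : ℓp * Real.log ω ≤ ℓ * Real.log ω := mul_le_mul_of_nonneg_right hℓp_le hlogω0
    linarith
  have hθℓ : 2 * θ * Real.log ω ≤ ℓ * Real.log ω := by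
    have : 2 * θ ≤ ℓ := by rw [hθdef]; linarith
    exact mul_le_mul_of_nonneg_right this hlogω0
  have hηℓ : 4 * η ≤ 24 * C₀ * ℓ * Real.log ω := by
    have e : 4 * η = 24 * C₀ * ℓ := by rw [hηdef]; ring
    rw [e]
    exact le_mul_of_one_le_right (by positivity) hlogω1
  have hηℓ' : 4 * η * Real.log ω = 24 * C₀ * ℓ * Real.log ω := by rw [hηdef]; ring
  calc _ ≤ (4 * η * Real.log ω + 4 * η) + (6 + 2 * θ * Real.log ω) := add_le_add hhigh' hlow'
    _ ≤ (48 * C₀ + 2) * ℓ * Real.log ω := by linarith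
    _ = (48 * C₀ + 2) * (Real.log (Real.log H) / Real.log H) * Real.log ω := by rw [hℓdef]



/-! ### Proposition 2.4 from the schema -/

open MRT2015 in
/-- **Tao 2016, Proposition 2.4, from Theorem A.2 with middle term `mid`.**  For any `mid : ℝ → ℝ` with
`mid ≥ 0` on `[0, ∞)`, antitone on `[1, ∞)` and `√(mid(12 log W - 48)) ≤ C_m W^{-5/4}` for `W ≥ W₁`:
`TheoremA2With mid → Tao2016_prop24` (`MRT2015.A2With.theorem17With`, then `Tao2016_prop24_of_theorem17With`).
[cite: TaoFMP2016, Proposition 2.4] [cite: MatomakiRadziwillTao2015, Theorem 1.7] -/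
theorem Tao2016_prop24_of_theoremA2With {mid : ℝ → ℝ} (hmid0 : ∀ M : ℝ, 0 ≤ M → 0 ≤ mid M)
    (hanti : ∀ a b : ℝ, 1 ≤ a → a ≤ b → mid b ≤ mid a) (hA2 : TheoremA2With mid)
    {Cm W₁ : ℝ} (hCm : 0 ≤ Cm)
    (hdecay : ∀ W : ℝ, W₁ ≤ W → Real.sqrt (mid (12 * Real.log W - 48)) ≤ Cm * W ^ (-(5 : ℝ) / 4)) :
    Tao2016_prop24 :=
  Tao2016_prop24_of_theorem17With (A2With.theorem17With hmid0 hanti hA2 hCm hdecay)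

/-- `u ↦ (1 + u) e^{-u/2}` is antitone on `[1, ∞)`: for `1 ≤ a ≤ b`,
`(1 + b) e^{-b/2} ≤ (1 + a) e^{-a/2}` (`1 + b ≤ (1 + a)(1 + (b - a)/2) ≤ (1 + a) e^{(b-a)/2}`). [folklore] -/
theorem one_add_mul_exp_neg_half_antitone {a b : ℝ} (ha : 1 ≤ a) (hab : a ≤ b) :
    (1 + b) * Real.exp (-b / 2) ≤ (1 + a) * Real.exp (-a / 2) := by
  have h1 : 1 + (b - a) / 2 ≤ Real.exp ((b - a) / 2) := by
    have := Real.add_one_le_exp ((b - a) / 2); linarith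
  have h2 : (1 + b) ≤ (1 + a) * (1 + (b - a) / 2) := by nlinarith
  have h3 : (1 + b) ≤ (1 + a) * Real.exp ((b - a) / 2) :=
    h2.trans (mul_le_mul_of_nonneg_left h1 (by linarith))
  have h4 : Real.exp (-b / 2) = Real.exp (-a / 2) * (Real.exp ((b - a) / 2))⁻¹ := by
    rw [← Real.exp_neg, ← Real.exp_add]; congr 1; ring
  rw [h4]
  have h5 : 0 < Real.exp ((b - a) / 2) := Real.exp_pos _
  have h6 : 0 < Real.exp (-a / 2) := Real.exp_pos _
  have h7 : (1 + b) * (Real.exp ((b - a) / 2))⁻¹ ≤ 1 + a := by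
    rw [← div_eq_mul_inv, div_le_iff₀ h5]; exact h3
  calc (1 + b) * (Real.exp (-a / 2) * (Real.exp ((b - a) / 2))⁻¹)
      = ((1 + b) * (Real.exp ((b - a) / 2))⁻¹) * Real.exp (-a / 2) := by ring
    _ ≤ (1 + a) * Real.exp (-a / 2) := mul_le_mul_of_nonneg_right h7 h6.le

/-- `log W ≤ W^{1/2}` for `W ≥ 1`. [folklore] -/
theorem log_le_sqrt_rpow {W : ℝ} (hW : 1 ≤ W) : Real.log W ≤ W ^ (1 / 2 : ℝ) := by
  have hW0 : 0 < W := by linarith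
  have hpos : 0 < W ^ (1 / 2 : ℝ) := Real.rpow_pos_of_pos hW0 _
  have h1 : Real.log W = 2 * Real.log (W ^ (1 / 2 : ℝ)) := by
    rw [Real.log_rpow hW0]; ring
  have h2 : Real.log (W ^ (1 / 2 : ℝ)) ≤ W ^ (1 / 2 : ℝ) / 2 := by
    have h3 := Real.log_le_sub_one_of_pos (show 0 < W ^ (1 / 2 : ℝ) / 2 by positivity)
    have h4 : Real.log (W ^ (1 / 2 : ℝ)) = Real.log (W ^ (1 / 2 : ℝ) / 2) + Real.log 2 := by
      rw [Real.log_div hpos.ne' (by norm_num)]; ring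
    have h5 : Real.log 2 ≤ 1 := by
      have := Real.log_two_lt_d9; linarith
    linarith
  linarith

open MRT2015 in
/-- **The restricted-Halász middle term.**  If Theorem A.2 holds for completely multiplicative `f` with the
middle term `C (1 + M) e^{-M/2}` (`C ≥ 0`), then Tao's Proposition 2.4 holds:
`√(C (12 log W - 47) e^{24} W^{-6}) ≤ √(12 C e^{24}) W^{-5/4}` for `W ≥ e⁴` (`log W ≤ W^{1/2}`,
`W^{1/2 - 6} ≤ W^{-5/2}`). [cite: TaoFMP2016, Proposition 2.4] -/
theorem Tao2016_prop24_of_theoremA2With_exp_half {C : ℝ} (hC : 0 ≤ C)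
    (hA2 : TheoremA2With (fun M => C * (1 + M) * Real.exp (-M / 2))) : Tao2016_prop24 := by
  refine Tao2016_prop24_of_theoremA2With (mid := fun M => C * (1 + M) * Real.exp (-M / 2))
    (fun M hM => by positivity) (fun a b ha hab => ?_) hA2 (Cm := Real.sqrt (12 * C * Real.exp 24))
    (W₁ := Real.exp 4) (Real.sqrt_nonneg _) (fun W hW => ?_)
  · have key := one_add_mul_exp_neg_half_antitone ha hab
    calc C * (1 + b) * Real.exp (-b / 2) = C * ((1 + b) * Real.exp (-b / 2)) := by ring
      _ ≤ C * ((1 + a) * Real.exp (-a / 2)) := mul_le_mul_of_nonneg_left key hC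
      _ = C * (1 + a) * Real.exp (-a / 2) := by ring
  · have hW4 : 4 ≤ Real.log W := by
      rw [← Real.log_exp 4]; exact Real.log_le_log (Real.exp_pos 4) hW
    have hW1 : 1 ≤ W := le_trans (Real.one_le_exp (by norm_num)) hW
    have hW0 : 0 < W := by linarith
    -- `e^{-(12 log W - 48)/2} = e^{24} W^{-6}`
    have he : Real.exp (-(12 * Real.log W - 48) / 2) = Real.exp 24 * W ^ (-(6 : ℝ)) := by
      rw [show -(12 * Real.log W - 48) / 2 = 24 + (-(6 : ℝ)) * Real.log W by ring, Real.exp_add,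
        Real.rpow_def_of_pos hW0, mul_comm (Real.log W)]
    have hlog_le : Real.log W ≤ W ^ (1 / 2 : ℝ) := log_le_sqrt_rpow hW1
    have hfac : C * (1 + (12 * Real.log W - 48)) * Real.exp (-(12 * Real.log W - 48) / 2) ≤
        (12 * C * Real.exp 24) * (W ^ (1 / 2 : ℝ) * W ^ (-(6 : ℝ))) := by
      rw [he]
      have h1 : 1 + (12 * Real.log W - 48) ≤ 12 * W ^ (1 / 2 : ℝ) := by linarith
      have h0 : 0 ≤ Real.exp 24 * W ^ (-(6 : ℝ)) := by positivity
      have hl0 : 0 ≤ 1 + (12 * Real.log W - 48) := by linarith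
      calc C * (1 + (12 * Real.log W - 48)) * (Real.exp 24 * W ^ (-(6 : ℝ)))
          ≤ C * (12 * W ^ (1 / 2 : ℝ)) * (Real.exp 24 * W ^ (-(6 : ℝ))) := by
            refine mul_le_mul_of_nonneg_right (mul_le_mul_of_nonneg_left h1 hC) h0
        _ = (12 * C * Real.exp 24) * (W ^ (1 / 2 : ℝ) * W ^ (-(6 : ℝ))) := by ring
    have hpow : W ^ (1 / 2 : ℝ) * W ^ (-(6 : ℝ)) ≤ (W ^ (-(5 : ℝ) / 4)) ^ 2 := by
      rw [← Real.rpow_add hW0, ← Real.rpow_natCast, ← Real.rpow_mul hW0.le]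
      norm_num
      exact Real.rpow_le_rpow_of_exponent_le hW1 (by norm_num)
    have hsq : C * (1 + (12 * Real.log W - 48)) * Real.exp (-(12 * Real.log W - 48) / 2) ≤
        (Real.sqrt (12 * C * Real.exp 24) * W ^ (-(5 : ℝ) / 4)) ^ 2 := by
      rw [mul_pow, Real.sq_sqrt (by positivity)]
      exact hfac.trans (mul_le_mul_of_nonneg_left hpow (by positivity))
    calc Real.sqrt (C * (1 + (12 * Real.log W - 48)) * Real.exp (-(12 * Real.log W - 48) / 2))
        ≤ Real.sqrt ((Real.sqrt (12 * C * Real.exp 24) * W ^ (-(5 : ℝ) / 4)) ^ 2) := Real.sqrt_le_sqrt hsq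
      _ = Real.sqrt (12 * C * Real.exp 24) * W ^ (-(5 : ℝ) / 4) := Real.sqrt_sq (by positivity)

end Literature.NumberTheory.LFunctions

end
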